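import Summits.AnomalousDissipation.AnomalousDissipation.Theorems.SolenoidalFractalHomogenisationLagrangianStepSidebandXEnergy
import Summits.AnomalousDissipation.AnomalousDissipation.Theorems.SolenoidalFractalHomogenisationLagrangianStepSidebandXApriori
import Summits.AnomalousDissipation.AnomalousDissipation.Theorems.SolenoidalFractalHomogenisationLagrangianStepCellLawVEffectiveMode
import HarnessLib

/-!
# K1L_D `LagrangianRenormalisationStepDesign` (stmt-AnomalousDissipation-27980), `stub_D1_V0R` (ruling D27-1), brick T8c-1: THE INITIAL DATA of the
# sideband objects for the single-mode datum `Re e_ℓ·p` — `Z 0 = 0`, `x 0 = ½ pᶜ`, `r 0 = −projX (y 0)`, `‖r 0‖ ≤ ξ·C_N·‖x 0‖`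
# (helper; `--kind proof --supports stmt-AnomalousDissipation-27980 --as helper`)

Summits-side helper file of route `SolenoidalFractalHomogenisation` (prover seat `ad-k1l-cellLawV-w1` g7; 0 sorry, no defs, no named facts).  For the datum
of clause (V), `F = Re e_ℓ·p` with `p ⊥ ℓ`, `ℓ ≠ 0`, and `2|ℓ| < n` (so that no class frequency `ℓ + n·z`, `z ≠ 0`, hits `±ℓ`): the box vector starts
at `0`, the slow mode at `½pᶜ`, hence the residual of `…SidebandXEnergyDefs` starts at `−projX (y 0)` — the INITIAL LAYER of size `ξ·C_N·‖x 0‖` whose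
fast decay is why the forcing of the averaged slow equation is measured in weighted `L¹` (`…SidebandXSlowAveragingWeighted`).
* `mFourierCoeff_singleMode_of_ne` — `𝓕(Re e_ℓ·p)(k) = 0` off `±ℓ`; `classFreq_ne_neg_self` — `ℓ + n·z ≠ −ℓ` on the box (`2|ℓ| < n`);
* **`sbVec_zero_eq_zero`**, **`modeRep_self_zero`** (`= ½pᶜ`), **`residualX_zero`**, **`norm_residualX_zero_le`**.
NOT a proof of any registered stub, of K1L_D, or of anomalous dissipation; rung F-D1.A0 infrastructure.
-/

set_option linter.dupNamespace false

noncomputable section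

namespace Summit.AnomalousDissipation.AnomalousDissipation.Theorems.SolenoidalFractalHomogenisation.LagrangianStep.Sideband

open Set MeasureTheory Complex UnitAddTorus
open scoped InnerProductSpace
open Literature.Analysis Literature.Analysis.FunctionSpaces Literature.Analysis.FunctionSpaces.Torus
open Literature.Analysis.FluidPDE Literature.Analysis.FluidPDE.Torus Literature.Analysis.FluidPDE.LatticeShear
open Summit.AnomalousDissipation.AnomalousDissipation.Theorems.SolenoidalFractalHomogenisation.LagrangianStep.CellChain (modeRep modeRep_zero)
open Summit.AnomalousDissipation.AnomalousDissipation.Theorems.SolenoidalFractalHomogenisation.RealisedQuasiStaticCellLaw (singleMode_eq_realTrigPoly)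
open Summit.AnomalousDissipation.AnomalousDissipation.Theorems.SolenoidalFractalHomogenisation.LagrangianStep (mFourierCoeff_singleMode_self)

variable {k₀ : ℕ}

/-! ## §1 The datum's Fourier coefficients off `±ℓ`; class frequencies never hit `−ℓ` -/

/-- `𝓕(Re e_ℓ·p)(k) = 0` for `k ≠ ℓ`, `k ≠ −ℓ`. [folklore] -/
theorem mFourierCoeff_singleMode_of_ne {ℓ k : Fin 3 → ℤ} (hk : k ≠ ℓ) (hk' : k ≠ -ℓ) (p : EuclideanSpace ℝ (Fin 3)) :
    mFourierCoeff (FunctionSpaces.EuclideanSpace.complexify ∘ fun x : UnitAddTorus (Fin 3) => (UnitAddTorus.mFourier ℓ x).re • p) k = 0 := by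
  rw [singleMode_eq_realTrigPoly, mFourierCoeff_realTrigPoly_singleton, if_neg hk, if_neg hk', FunctionSpaces.EuclideanSpace.conjVec_zero,
    add_zero, smul_zero]

/-- On the box, `ℓ + n·z ≠ −ℓ` when `2|ℓ| < n`. [cite: MajdaKramer1999, §2.2.1.3] -/
theorem classFreq_ne_neg_self {n : ℕ} {ℓ : Fin 3 → ℤ} (hℓ : 2 * Real.sqrt (freqNormSq ℓ) < n) {R : ℕ} (z : box R) :
    classFreq n ℓ z.1 ≠ -ℓ := by
  intro h
  have hz0 : (z : Fin 3 → ℤ) ≠ 0 := ne_zero_of_mem_box z.2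
  -- `n z = −2ℓ`
  have hi : ∀ i, (n : ℝ) * (z.1 i : ℝ) = -2 * (ℓ i : ℝ) := by
    intro i
    have := congrFun h i
    simp only [classFreq_apply, Pi.neg_apply] at this
    have h' : (n : ℤ) * z.1 i = -2 * ℓ i := by linarith
    exact_mod_cast h'
  have hsq : (n : ℝ) ^ 2 * freqNormSq z.1 = 4 * freqNormSq ℓ := by
    simp only [freqNormSq, Finset.mul_sum]
    refine Finset.sum_congr rfl fun i _ => ?_
    have := hi i
    calc (n : ℝ) ^ 2 * ((z.1 i : ℝ)) ^ 2 = ((n : ℝ) * (z.1 i : ℝ)) ^ 2 := by ring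
      _ = (-2 * (ℓ i : ℝ)) ^ 2 := by rw [this]
      _ = 4 * (ℓ i : ℝ) ^ 2 := by ring
  have hZ1 : 1 ≤ freqNormSq z.1 := Torus.one_le_freqNormSq_of_ne_zero hz0
  have hn : (0 : ℝ) ≤ n := Nat.cast_nonneg n
  have hsl : 0 ≤ Real.sqrt (freqNormSq ℓ) := Real.sqrt_nonneg _
  have h2 : freqNormSq ℓ = Real.sqrt (freqNormSq ℓ) ^ 2 := (Real.sq_sqrt (freqNormSq_nonneg ℓ)).symm
  nlinarith [hsq, hZ1, h2, hℓ, mul_nonneg hn hsl]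

/-! ## §2 Initial values -/

/-- **The box vector starts at zero** for the datum `Re e_ℓ·p` (`2|ℓ| < n`, `n ≥ 1`). [cite: MajdaKramer1999, §2.2.1.3] -/
theorem sbVec_zero_eq_zero (W₁ : LatticeWord k₀) {n : ℕ} (hn : n ≠ 0) (𝔹 : Torus.Visc4 (Fin 3)) {ℓ : Fin 3 → ℤ} (hℓ : 2 * Real.sqrt (freqNormSq ℓ) < n)
    (p : EuclideanSpace ℝ (Fin 3)) (w : ℝ → UnitAddTorus (Fin 3) → EuclideanSpace ℝ (Fin 3)) (R : ℕ) :
    sbVec W₁ n 𝔹 (fun x => (UnitAddTorus.mFourier ℓ x).re • p) w ℓ R 0 = 0 := by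
  apply PiLp.ext
  intro z
  rw [sbVec_apply, modeRep_zero, mFourierCoeff_singleMode_of_ne (classFreq_ne_self hn ℓ z) (classFreq_ne_neg_self hℓ z) p, map_zero]
  simp

/-- `ℓ · pᶜ = 0` for `p ⊥ ℓ`. [cite: Temam1984, Ch. III §1.1] -/
theorem kdot_complexify_eq_zero {ℓ : Fin 3 → ℤ} {p : EuclideanSpace ℝ (Fin 3)} (hpℓ : ⟪p, Torus.latticeVec ℓ⟫_ℝ = 0) :
    kdot ℓ (FunctionSpaces.EuclideanSpace.complexify p) = 0 := by
  rw [kdot_apply]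
  have h : ∑ j, (ℓ j : ℂ) * FunctionSpaces.EuclideanSpace.complexify p j = ((∑ j, p j * (ℓ j : ℝ) : ℝ) : ℂ) := by
    push_cast
    refine Finset.sum_congr rfl fun j _ => ?_
    rw [FunctionSpaces.EuclideanSpace.complexify_apply]; ring
  rw [h]
  have h2 : ∑ j, p j * (ℓ j : ℝ) = ⟪p, Torus.latticeVec ℓ⟫_ℝ := by
    rw [EuclideanSpace.inner_eq_star_dotProduct]
    simp only [dotProduct, star_trivial, Torus.latticeVec_apply]
    exact Finset.sum_congr rfl fun j _ => mul_comm _ _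
  rw [h2, hpℓ, Complex.ofReal_zero]

/-- **The slow mode starts at `½pᶜ`** (`ℓ ≠ 0`, `p ⊥ ℓ`). [cite: Temam1984, Ch. III §1.1] -/
theorem modeRep_self_zero (W₁ : LatticeWord k₀) (n : ℕ) (𝔹 : Torus.Visc4 (Fin 3)) {ℓ : Fin 3 → ℤ} (hℓ : ℓ ≠ 0)
    {p : EuclideanSpace ℝ (Fin 3)} (hpℓ : ⟪p, Torus.latticeVec ℓ⟫_ℝ = 0) (w : ℝ → UnitAddTorus (Fin 3) → EuclideanSpace ℝ (Fin 3)) :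
    modeRep W₁ n 𝔹 (fun x => (UnitAddTorus.mFourier ℓ x).re • p) w ℓ 0 = (2 : ℂ)⁻¹ • FunctionSpaces.EuclideanSpace.complexify p := by
  rw [modeRep_zero, mFourierCoeff_singleMode_self hℓ p, map_smul,
    ThreeMode.transversalProj_eq_self_of_kdot ℓ (kdot_complexify_eq_zero hpℓ)]

/-- **The residual starts at `−projX (y 0)`** (the initial layer). [cite: SandersVerhulstMurdock2007, Lemma 5.2.7 (linear case)] -/
theorem residualX_zero (W₁ : LatticeWord k₀) {n : ℕ} (hn : n ≠ 0) {ℓ : Fin 3 → ℤ} (hℓ : 2 * Real.sqrt (freqNormSq ℓ) < n) (𝔸 : Torus.Visc4 (Fin 3))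
    (R : ℕ) (p : EuclideanSpace ℝ (Fin 3)) (w : ℝ → UnitAddTorus (Fin 3) → EuclideanSpace ℝ (Fin 3)) :
    residualX W₁ n ℓ 𝔸 R (fun x => (UnitAddTorus.mFourier ℓ x).re • p) w 0 =
      -projX n ℓ R (refState W₁ n ℓ 𝔸 R (fun x => (UnitAddTorus.mFourier ℓ x).re • p) w 0) := by
  rw [residualX_apply, sbVec_zero_eq_zero W₁ hn _ hℓ p w R, zero_sub]

/-- **Size of the initial layer**: `‖r 0‖ ≤ ξ·(Σⱼ 8π‖αⱼ‖/min(1,4π²lo))·‖x 0‖`. [cite: SandersVerhulstMurdock2007, Lemma 5.2.7 (linear case)] -/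
theorem norm_residualX_zero_le (W₁ : LatticeWord k₀) {n : ℕ} (hn : n ≠ 0) {ℓ : Fin 3 → ℤ} (hℓ : 2 * Real.sqrt (freqNormSq ℓ) < n)
    {𝔸 : Torus.Visc4 (Fin 3)} {lo hi : ℝ} (h𝔸 : Torus.NearIso 𝔸 lo hi) (hlo : 0 < lo) (R : ℕ) (p : EuclideanSpace ℝ (Fin 3))
    (w : ℝ → UnitAddTorus (Fin 3) → EuclideanSpace ℝ (Fin 3)) :
    ‖residualX W₁ n ℓ 𝔸 R (fun x => (UnitAddTorus.mFourier ℓ x).re • p) w 0‖ ≤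
      (Real.sqrt (freqNormSq ℓ) / n) * (∑ j, 8 * Real.pi * ‖slotAmp W₁ j‖ / min 1 (4 * Real.pi ^ 2 * lo)) *
        ‖modeRep W₁ n ((1 / (n : ℝ) ^ 2) • 𝔸) (fun x => (UnitAddTorus.mFourier ℓ x).re • p) w ℓ 0‖ := by
  rw [residualX_zero W₁ hn hℓ 𝔸 R p w, norm_neg]
  exact (norm_projX_le n ℓ _).trans (norm_refState_le W₁ n ℓ h𝔸 hlo R _ w 0)

end Summit.AnomalousDissipation.AnomalousDissipation.Theorems.SolenoidalFractalHomogenisation.LagrangianStep.Sideband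

end
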